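import Literature.Barriers.CriticalPhenomena.PlaquetteWalkHoleRootLawLDichotomy
import Literature.Barriers.CriticalPhenomena.PlaquetteWalkHoleRootInteriorRing
import HarnessLib

/-!
# Barrier catalogue (SAWScalingLimit): LAW L IN THE INTERIOR OF A BOX — no ring cell other than the far cell's outer
neighbour kills a route; that one restores the vertex relation identically

Assembly leaf (no new mechanism, no new definition) of `PlaquetteWalkHoleRootLawLDichotomy` (boxes `boxMinus m n S`, the
schema blocks `westBlock` / `eastBlock` and the four interior corner blocks at every position, far cells kill nothing)
and `PlaquetteWalkHoleRootInteriorRing` (the eight ring witnesses `ringBlockUS2a`, `…US1a/b/c`, `…ON2a/b/c`, `…ON1a` at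
every position). Setting: the `m × n` box of faces, the hole `h` at distance `≥ 3` from every wall (its closed `7 × 7`
neighbourhood inside the box), the root plaquette `w = (h.1 + 1, h.2)` rooted at its `W` side, far cell `(h.1 − 1, h.2)`;
ONE further cell `(x, y)` removed. The four universal KILL statements of the lane's LAW L are, at the angle `θ`: every wound
class-`B2a` under-walk (first side `S`) is `w₂`-marked off the far cell / every wound over-walk (first side `N`) is
`w₁`-marked / every wound under-walk is `w₁`-marked / every wound over-walk is `w₂`-marked.

* §1 `block_hroot_subset_boxMinus_of_frame`: a reference block inside the frame `[0, 6] × [−1, 5]` of the reference root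
  `(4, 2)` that avoids the reference hole `(3, 2)` and a reference cell `e` sits, translated to `w`, inside the box minus
  the hole and the translate of `e` (pure bookkeeping; the sixty (cell, type) instances below are decided on the lists).
* §2 ★★★★★ `lawL_box_ring_not_killed`: `(x, y)` any of the SIXTEEN RING CELLS of the hole's closed `5 × 5` neighbourhood
  EXCEPT the far cell's outer neighbour `farWW = (h.1 − 2, h.2)` ⇒ at every angle NONE of the four kill statements holds —
  for each of the fifteen cells and each of the four witness types a landed block avoiding the cell is named (table in the
  proof; the nineteen pairs no older block serves are exactly the ring witnesses of `PlaquetteWalkHoleRootInteriorRing`).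
* §3 ★★★★ `lawL_box_farWW_eq_zero` (all boxes, hole anywhere with `2 ≤ h.1`): removing `farWW` closes a door of the far
  cell, and the vertex functional with the printed weights VANISHES identically on `[π/3, 2π/3]`
  (`vertexFunctional_printed_farCellW_eq_zero_of_door_closed`); the west-wall case `h.1 = 2` is
  `lawL_westWall_farWW_eq_zero` of `PlaquetteWalkHoleRootLawLWalls`.
* §4 ★★★★★ `lawL_box_interior_not_killed`: hole `≥ 3` from every wall, ANY single cell at Chebyshev distance `≥ 2` from the
  hole other than `farWW` removed ⇒ nothing is killed (ring: §2; distance `≥ 3`: `lawL_box_not_killed_of_far`). With §3 this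
  is LAW L in the interior in full: among all such removals exactly one cell acts, and it acts by restoring the relation.
  The rooted-face hypothesis is discharged by `rootedFace_hroot_boxMinus_cell`.

What is NOT here: cells at Chebyshev distance `1` from the hole (the far cell itself, the root plaquette, `farSW`, `farNW`,
the cells below/above the hole and the root) change the local three-door geometry and belong to the far-cell / diagonal
laws (`PlaquetteWalkHoleRootFarCellLaw`, `…DiagonalThreeDoor`), not to LAW L; holes at distance exactly `2` from a wall are
`PlaquetteWalkHoleRootLawLWalls`; holes next to a wall are `PlaquetteWalkHoleRootThinSide`.

Not in print; venture lane «pcv-sawmu», seat b-step0 gen 27 (FINDING-YB-KILL-FORCED-ZEROS §20).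

References: A. Glazman, I. Manolescu, arXiv:1708.00395v3, §1 (Fig. 1, Fig. 2, the remark after eq. (1)), §2.1, §4.2
(translation invariance) and Lemma 2.1 [GlazmanManolescu2019]; A. Glazman, Electron. Commun. Probab. 20 (2015) no. 86,
Lemma 3.1, proof pp. 6–7 [Glazman2015WeightedSAW]; R. Courant, H. Robbins, *What is Mathematics?* (1941/1958), Ch. V
Appendix §2 (the even–odd rule) [CourantRobbins1958].
-/

noncomputable section

open Set Function Complex

namespace Literature.Barriers.CriticalPhenomena.PlaquetteWalk

open Literature.Probability.RandomPlanarGeometry.SAW.YangBaxter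
open Real Complex

/-! ## §1 Reference blocks in the frame `[0, 6] × [−1, 5]` sit in the box -/

section Frame

variable {m n : ℕ} {h : Face}

/-- **A reference block in the `7 × 7` frame sits in the box.** If every cell of the reference block `B` (reference root
`(4, 2)`, hole `(3, 2)`) lies in the frame `0 ≤ a.1 ≤ 6`, `−1 ≤ a.2 ≤ 5`, is not the hole and is not the reference cell
`(ex, ey)`, and the hole `h` of the `m × n` box is at distance `≥ 3` from every wall, then the translate of `B` to the root
plaquette `(h.1 + 1, h.2)` lies in the box minus the hole and the translate `(cx, cy) = (h.1 + ex − 3, h.2 + ey − 2)` of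
the reference cell. [cite: GlazmanManolescu2019, §2.1 (finite domains of faces), §4.2 (translation invariance)] -/
theorem block_hroot_subset_boxMinus_of_frame (hW : 3 ≤ h.1) (hE : h.1 + 4 ≤ m) (hS : 3 ≤ h.2) (hN : h.2 + 4 ≤ n)
    (B : List Face) (ex ey : ℤ)
    (hB : ∀ a ∈ B, 0 ≤ a.1 ∧ a.1 ≤ 6 ∧ -1 ≤ a.2 ∧ a.2 ≤ 5 ∧ a ≠ (3, 2) ∧ a ≠ (ex, ey)) {cx cy : ℤ}
    (hc : cx = h.1 + ex - 3 ∧ cy = h.2 + ey - 2) :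
    ∀ c ∈ B.map (Face.shiftBy (refShift (h.1 + 1, h.2))), c ∈ boxMinus m n [h, (cx, cy)] := by
  intro c hc'
  rw [List.mem_map] at hc'
  obtain ⟨a, ha, rfl⟩ := hc'
  obtain ⟨b1, b2, b3, b4, b5, b6⟩ := hB a ha
  obtain ⟨x, y⟩ := a
  simp only [ne_eq, Prod.mk.injEq, not_and] at b1 b2 b3 b4 b5 b6
  obtain ⟨hc1, hc2⟩ := hc
  rw [shiftBy_refShift_mk, mem_boxMinus]
  simp only [List.mem_cons, List.not_mem_nil, or_false, not_or]
  refine ⟨⟨by omega, by omega, by omega, by omega⟩, fun e => ?_, fun e => ?_⟩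
  · have e' := Prod.ext_iff.1 e; simp only at e'; omega
  · have e' := Prod.ext_iff.1 e; simp only at e'; omega

/-- **The far cell of a box minus the hole and one more cell is rooted** (hole `≥ 2` from every wall, the removed cell not
the far cell). [cite: GlazmanManolescu2019, §2.1 (walks start on the boundary of the domain)] -/
theorem rootedFace_hroot_boxMinus_cell (hW : 2 ≤ h.1) (hE : h.1 + 3 ≤ m) (hS : 2 ≤ h.2) (hN : h.2 + 3 ≤ n) {x y : ℤ}
    (hc : ¬(x = h.1 - 1 ∧ y = h.2)) :
    RootedFace (dom (boxMinus m n [h, (x, y)])) (Face.side (h.1 + 1, h.2) .W) (farW (h.1 + 1, h.2)) := by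
  refine ⟨?_, fun hb => ?_⟩
  · rw [mem_dom_boxMinus]
    simp only [farW, List.mem_cons, List.not_mem_nil, or_false, not_or]
    refine ⟨⟨by omega, by omega, by omega, by omega⟩, fun e => ?_, fun e => ?_⟩
    · have e' := Prod.ext_iff.1 e; simp only at e'; omega
    · have e' := Prod.ext_iff.1 e; simp only at e'; omega
  · rw [root_faces_W, holeFaceW_hroot] at hb
    exact not_mem_dom_boxMinus_of_mem (by simp) hb.1

end Frame

/-! ## §2 No ring cell other than `farWW` kills a route -/

section Ring

variable {Dl : List Face} {w : Face}

/-- Four free wound witnesses (under `w₂`-free, over `w₁`-free, under `w₁`-free, over `w₂`-free) refute the four universal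
kill statements. [cite: GlazmanManolescu2019, §1 (Fig. 2 and the remark after eq. (1)), Lemma 2.1] -/
theorem not_killed_of_witnesses (hr : RootedFace (dom Dl) (w.side .W) (farW w)) (θ : ℝ)
    (h₁ : ∃ (ω : ΩG (dom Dl) (w.side .W) (farW w)) (h : ω.IsB2a), ω.2.firstSideG = .S ∧
      ω.WE (fun _ => θ) ≠ excursionWinding θ ω.2.firstSideG (ω.z1 hr h) ω.1 ∧ ω.2.W2FreeOff (farW w))
    (h₂ : ∃ (ω : ΩG (dom Dl) (w.side .W) (farW w)) (h : ω.IsB2a), ω.2.firstSideG = .N ∧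
      ω.WE (fun _ => θ) ≠ excursionWinding θ ω.2.firstSideG (ω.z1 hr h) ω.1 ∧ ω.2.W1FreeOff (farW w))
    (h₃ : ∃ (ω : ΩG (dom Dl) (w.side .W) (farW w)) (h : ω.IsB2a), ω.2.firstSideG = .S ∧
      ω.WE (fun _ => θ) ≠ excursionWinding θ ω.2.firstSideG (ω.z1 hr h) ω.1 ∧ ω.2.W1FreeOff (farW w))
    (h₄ : ∃ (ω : ΩG (dom Dl) (w.side .W) (farW w)) (h : ω.IsB2a), ω.2.firstSideG = .N ∧
      ω.WE (fun _ => θ) ≠ excursionWinding θ ω.2.firstSideG (ω.z1 hr h) ω.1 ∧ ω.2.W2FreeOff (farW w)) :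
    (¬ ∀ (ω : ΩG (dom Dl) (w.side .W) (farW w)) (h : ω.IsB2a), ω.2.firstSideG = .S →
        ω.WE (fun _ => θ) ≠ excursionWinding θ ω.2.firstSideG (ω.z1 hr h) ω.1 → ¬ω.2.W2FreeOff (farW w)) ∧
      (¬ ∀ (ω : ΩG (dom Dl) (w.side .W) (farW w)) (h : ω.IsB2a), ω.2.firstSideG = .N →
        ω.WE (fun _ => θ) ≠ excursionWinding θ ω.2.firstSideG (ω.z1 hr h) ω.1 → ¬ω.2.W1FreeOff (farW w)) ∧
      (¬ ∀ (ω : ΩG (dom Dl) (w.side .W) (farW w)) (h : ω.IsB2a), ω.2.firstSideG = .S →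
        ω.WE (fun _ => θ) ≠ excursionWinding θ ω.2.firstSideG (ω.z1 hr h) ω.1 → ¬ω.2.W1FreeOff (farW w)) ∧
      (¬ ∀ (ω : ΩG (dom Dl) (w.side .W) (farW w)) (h : ω.IsB2a), ω.2.firstSideG = .N →
        ω.WE (fun _ => θ) ≠ excursionWinding θ ω.2.firstSideG (ω.z1 hr h) ω.1 → ¬ω.2.W2FreeOff (farW w)) := by
  refine ⟨fun hk => ?_, fun hk => ?_, fun hk => ?_, fun hk => ?_⟩
  · obtain ⟨ω, h, hs, hw, hf⟩ := h₁; exact hk ω h hs hw hf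
  · obtain ⟨ω, h, hs, hw, hf⟩ := h₂; exact hk ω h hs hw hf
  · obtain ⟨ω, h, hs, hw, hf⟩ := h₃; exact hk ω h hs hw hf
  · obtain ⟨ω, h, hs, hw, hf⟩ := h₄; exact hk ω h hs hw hf

variable {m n : ℕ} {h : Face}

/-- ★★★★★ **LAW L IN THE INTERIOR: NO RING CELL OTHER THAN `farWW` KILLS A ROUTE.** In the `m × n` box with the hole `h` at
distance `≥ 3` from every wall, remove the hole and ONE cell `(x, y)` of the boundary ring of the hole's closed `5 × 5`
neighbourhood (`max(|x − h.1|, |y − h.2|) = 2`) other than the far cell's outer neighbour `(h.1 − 2, h.2)`. Then at every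
angle the far cell of the root plaquette `(h.1 + 1, h.2)` carries wound class-`B2a` under- AND over-walks free of `w₂`
and free of `w₁` off the far cell: NONE of the four universal kill statements of LAW L holds. Table of the witness blocks
used (reference coordinates, hole `(3, 2)`; types under `w₂`-free / over `w₁`-free / under `w₁`-free / over `w₂`-free):
`(1,0)`: ISW · ON1a · W · W; `(1,1)`: ISW · ON1a · US1c · ON2a; `(1,3)`: US2a · INW · US1a · ON2c; `(1,4)`: US2a · INW · W · W;
`(2,0)`, `(3,0)`, `(4,0)`: ISW · INW · US1a · ON2a; `(2,4)`, `(3,4)`, `(4,4)`: ISW · INW · US1a · ON2a; `(5,0)`: E · E · ISE ·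
ON2a; `(5,1)`: US2a · ON1a · US1b · ON2a; `(5,2)`: US2a · ON1a · US1b · ON2b; `(5,3)`: US2a · ON1a · US1a · ON2b; `(5,4)`:
E · E · US1a · INE (`W`/`E` = `westBlock`/`eastBlock`, `ISW…INE` = `interiorBlockSW…NE`, the rest `ringBlock…`).
[cite: GlazmanManolescu2019, §1 (Fig. 2 and the remark after eq. (1)), §2.1, §4.2, Lemma 2.1]
[cite: Glazman2015WeightedSAW, Lemma 3.1 (proof, pp. 6–7)] [cite: CourantRobbins1958, Ch. V Appendix §2 (the even–odd rule)] -/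
theorem lawL_box_ring_not_killed (hW : 3 ≤ h.1) (hE : h.1 + 4 ≤ m) (hS : 3 ≤ h.2) (hN : h.2 + 4 ≤ n) {x y : ℤ}
    (hring : ((x = h.1 - 2 ∨ x = h.1 + 2) ∧ h.2 - 2 ≤ y ∧ y ≤ h.2 + 2) ∨
      ((y = h.2 - 2 ∨ y = h.2 + 2) ∧ h.1 - 2 ≤ x ∧ x ≤ h.1 + 2))
    (hWW : ¬(x = h.1 - 2 ∧ y = h.2))
    (hr : RootedFace (dom (boxMinus m n [h, (x, y)])) (Face.side (h.1 + 1, h.2) .W) (farW (h.1 + 1, h.2))) (θ : ℝ) :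
    (¬ ∀ (ω : ΩG (dom (boxMinus m n [h, (x, y)])) (Face.side (h.1 + 1, h.2) .W) (farW (h.1 + 1, h.2))) (hb : ω.IsB2a),
        ω.2.firstSideG = .S → ω.WE (fun _ => θ) ≠ excursionWinding θ ω.2.firstSideG (ω.z1 hr hb) ω.1 →
          ¬ω.2.W2FreeOff (farW (h.1 + 1, h.2))) ∧
      (¬ ∀ (ω : ΩG (dom (boxMinus m n [h, (x, y)])) (Face.side (h.1 + 1, h.2) .W) (farW (h.1 + 1, h.2))) (hb : ω.IsB2a),
        ω.2.firstSideG = .N → ω.WE (fun _ => θ) ≠ excursionWinding θ ω.2.firstSideG (ω.z1 hr hb) ω.1 →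
          ¬ω.2.W1FreeOff (farW (h.1 + 1, h.2))) ∧
      (¬ ∀ (ω : ΩG (dom (boxMinus m n [h, (x, y)])) (Face.side (h.1 + 1, h.2) .W) (farW (h.1 + 1, h.2))) (hb : ω.IsB2a),
        ω.2.firstSideG = .S → ω.WE (fun _ => θ) ≠ excursionWinding θ ω.2.firstSideG (ω.z1 hr hb) ω.1 →
          ¬ω.2.W1FreeOff (farW (h.1 + 1, h.2))) ∧
      (¬ ∀ (ω : ΩG (dom (boxMinus m n [h, (x, y)])) (Face.side (h.1 + 1, h.2) .W) (farW (h.1 + 1, h.2))) (hb : ω.IsB2a),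
        ω.2.firstSideG = .N → ω.WE (fun _ => θ) ≠ excursionWinding θ ω.2.firstSideG (ω.z1 hr hb) ω.1 →
          ¬ω.2.W2FreeOff (farW (h.1 + 1, h.2))) := by
  have sub := block_hroot_subset_boxMinus_of_frame (m := m) (n := n) hW hE hS hN
  rcases hring with ⟨hx, hy1, hy2⟩ | ⟨hy, hx1, hx2⟩
  · have hy : y = h.2 - 2 ∨ y = h.2 - 1 ∨ y = h.2 ∨ y = h.2 + 1 ∨ y = h.2 + 2 := by omega
    rcases hx with rfl | rfl
    · -- west column of the ring: reference cells (1,0), (1,1), [(1,2) = farWW excluded], (1,3), (1,4)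
      rcases hy with rfl | rfl | rfl | rfl | rfl
      · exact not_killed_of_witnesses hr θ
          (exists_under_w2free_of_interiorBlockSW (sub interiorBlockSW42 1 0 (by decide) ⟨by omega, by omega⟩) hr θ)
          (exists_over_W1FreeOff_of_ringBlockON1a (sub ringBlockON1a42 1 0 (by decide) ⟨by omega, by omega⟩) hr θ)
          (exists_under_w1free_of_westBlock (sub westBlock42 1 0 (by decide) ⟨by omega, by omega⟩) hr θ)
          (exists_over_w2free_of_westBlock (sub westBlock42 1 0 (by decide) ⟨by omega, by omega⟩) hr θ)
      · exact not_killed_of_witnesses hr θ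
          (exists_under_w2free_of_interiorBlockSW (sub interiorBlockSW42 1 1 (by decide) ⟨by omega, by omega⟩) hr θ)
          (exists_over_W1FreeOff_of_ringBlockON1a (sub ringBlockON1a42 1 1 (by decide) ⟨by omega, by omega⟩) hr θ)
          (exists_under_W1FreeOff_of_ringBlockUS1c (sub ringBlockUS1c42 1 1 (by decide) ⟨by omega, by omega⟩) hr θ)
          (exists_over_W2FreeOff_of_ringBlockON2a (sub ringBlockON2a42 1 1 (by decide) ⟨by omega, by omega⟩) hr θ)
      · exact absurd ⟨rfl, rfl⟩ hWW
      · exact not_killed_of_witnesses hr θ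
          (exists_under_W2FreeOff_of_ringBlockUS2a (sub ringBlockUS2a42 1 3 (by decide) ⟨by omega, by omega⟩) hr θ)
          (exists_over_w1free_of_interiorBlockNW (sub interiorBlockNW42 1 3 (by decide) ⟨by omega, by omega⟩) hr θ)
          (exists_under_W1FreeOff_of_ringBlockUS1a (sub ringBlockUS1a42 1 3 (by decide) ⟨by omega, by omega⟩) hr θ)
          (exists_over_W2FreeOff_of_ringBlockON2c (sub ringBlockON2c42 1 3 (by decide) ⟨by omega, by omega⟩) hr θ)
      · exact not_killed_of_witnesses hr θ
          (exists_under_W2FreeOff_of_ringBlockUS2a (sub ringBlockUS2a42 1 4 (by decide) ⟨by omega, by omega⟩) hr θ)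
          (exists_over_w1free_of_interiorBlockNW (sub interiorBlockNW42 1 4 (by decide) ⟨by omega, by omega⟩) hr θ)
          (exists_under_w1free_of_westBlock (sub westBlock42 1 4 (by decide) ⟨by omega, by omega⟩) hr θ)
          (exists_over_w2free_of_westBlock (sub westBlock42 1 4 (by decide) ⟨by omega, by omega⟩) hr θ)
    · -- east column of the ring: reference cells (5,0) … (5,4)
      rcases hy with rfl | rfl | rfl | rfl | rfl
      · exact not_killed_of_witnesses hr θ
          (exists_under_w2free_of_eastBlock (sub eastBlock42 5 0 (by decide) ⟨by omega, by omega⟩) hr θ)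
          (exists_over_w1free_of_eastBlock (sub eastBlock42 5 0 (by decide) ⟨by omega, by omega⟩) hr θ)
          (exists_under_w1free_of_interiorBlockSE (sub interiorBlockSE42 5 0 (by decide) ⟨by omega, by omega⟩) hr θ)
          (exists_over_W2FreeOff_of_ringBlockON2a (sub ringBlockON2a42 5 0 (by decide) ⟨by omega, by omega⟩) hr θ)
      · exact not_killed_of_witnesses hr θ
          (exists_under_W2FreeOff_of_ringBlockUS2a (sub ringBlockUS2a42 5 1 (by decide) ⟨by omega, by omega⟩) hr θ)
          (exists_over_W1FreeOff_of_ringBlockON1a (sub ringBlockON1a42 5 1 (by decide) ⟨by omega, by omega⟩) hr θ)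
          (exists_under_W1FreeOff_of_ringBlockUS1b (sub ringBlockUS1b42 5 1 (by decide) ⟨by omega, by omega⟩) hr θ)
          (exists_over_W2FreeOff_of_ringBlockON2a (sub ringBlockON2a42 5 1 (by decide) ⟨by omega, by omega⟩) hr θ)
      · exact not_killed_of_witnesses hr θ
          (exists_under_W2FreeOff_of_ringBlockUS2a (sub ringBlockUS2a42 5 2 (by decide) ⟨by omega, by omega⟩) hr θ)
          (exists_over_W1FreeOff_of_ringBlockON1a (sub ringBlockON1a42 5 2 (by decide) ⟨by omega, by omega⟩) hr θ)
          (exists_under_W1FreeOff_of_ringBlockUS1b (sub ringBlockUS1b42 5 2 (by decide) ⟨by omega, by omega⟩) hr θ)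
          (exists_over_W2FreeOff_of_ringBlockON2b (sub ringBlockON2b42 5 2 (by decide) ⟨by omega, by omega⟩) hr θ)
      · exact not_killed_of_witnesses hr θ
          (exists_under_W2FreeOff_of_ringBlockUS2a (sub ringBlockUS2a42 5 3 (by decide) ⟨by omega, by omega⟩) hr θ)
          (exists_over_W1FreeOff_of_ringBlockON1a (sub ringBlockON1a42 5 3 (by decide) ⟨by omega, by omega⟩) hr θ)
          (exists_under_W1FreeOff_of_ringBlockUS1a (sub ringBlockUS1a42 5 3 (by decide) ⟨by omega, by omega⟩) hr θ)
          (exists_over_W2FreeOff_of_ringBlockON2b (sub ringBlockON2b42 5 3 (by decide) ⟨by omega, by omega⟩) hr θ)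
      · exact not_killed_of_witnesses hr θ
          (exists_under_w2free_of_eastBlock (sub eastBlock42 5 4 (by decide) ⟨by omega, by omega⟩) hr θ)
          (exists_over_w1free_of_eastBlock (sub eastBlock42 5 4 (by decide) ⟨by omega, by omega⟩) hr θ)
          (exists_under_W1FreeOff_of_ringBlockUS1a (sub ringBlockUS1a42 5 4 (by decide) ⟨by omega, by omega⟩) hr θ)
          (exists_over_w2free_of_interiorBlockNE (sub interiorBlockNE42 5 4 (by decide) ⟨by omega, by omega⟩) hr θ)
  · have hx : x = h.1 - 2 ∨ x = h.1 - 1 ∨ x = h.1 ∨ x = h.1 + 1 ∨ x = h.1 + 2 := by omega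
    rcases hy with rfl | rfl
    · -- bottom row of the ring: reference cells (1,0) … (5,0)
      rcases hx with rfl | rfl | rfl | rfl | rfl
      · exact not_killed_of_witnesses hr θ
          (exists_under_w2free_of_interiorBlockSW (sub interiorBlockSW42 1 0 (by decide) ⟨by omega, by omega⟩) hr θ)
          (exists_over_W1FreeOff_of_ringBlockON1a (sub ringBlockON1a42 1 0 (by decide) ⟨by omega, by omega⟩) hr θ)
          (exists_under_w1free_of_westBlock (sub westBlock42 1 0 (by decide) ⟨by omega, by omega⟩) hr θ)
          (exists_over_w2free_of_westBlock (sub westBlock42 1 0 (by decide) ⟨by omega, by omega⟩) hr θ)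
      · exact not_killed_of_witnesses hr θ
          (exists_under_w2free_of_interiorBlockSW (sub interiorBlockSW42 2 0 (by decide) ⟨by omega, by omega⟩) hr θ)
          (exists_over_w1free_of_interiorBlockNW (sub interiorBlockNW42 2 0 (by decide) ⟨by omega, by omega⟩) hr θ)
          (exists_under_W1FreeOff_of_ringBlockUS1a (sub ringBlockUS1a42 2 0 (by decide) ⟨by omega, by omega⟩) hr θ)
          (exists_over_W2FreeOff_of_ringBlockON2a (sub ringBlockON2a42 2 0 (by decide) ⟨by omega, by omega⟩) hr θ)
      · exact not_killed_of_witnesses hr θ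
          (exists_under_w2free_of_interiorBlockSW (sub interiorBlockSW42 3 0 (by decide) ⟨by omega, by omega⟩) hr θ)
          (exists_over_w1free_of_interiorBlockNW (sub interiorBlockNW42 3 0 (by decide) ⟨by omega, by omega⟩) hr θ)
          (exists_under_W1FreeOff_of_ringBlockUS1a (sub ringBlockUS1a42 3 0 (by decide) ⟨by omega, by omega⟩) hr θ)
          (exists_over_W2FreeOff_of_ringBlockON2a (sub ringBlockON2a42 3 0 (by decide) ⟨by omega, by omega⟩) hr θ)
      · exact not_killed_of_witnesses hr θ
          (exists_under_w2free_of_interiorBlockSW (sub interiorBlockSW42 4 0 (by decide) ⟨by omega, by omega⟩) hr θ)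
          (exists_over_w1free_of_interiorBlockNW (sub interiorBlockNW42 4 0 (by decide) ⟨by omega, by omega⟩) hr θ)
          (exists_under_W1FreeOff_of_ringBlockUS1a (sub ringBlockUS1a42 4 0 (by decide) ⟨by omega, by omega⟩) hr θ)
          (exists_over_W2FreeOff_of_ringBlockON2a (sub ringBlockON2a42 4 0 (by decide) ⟨by omega, by omega⟩) hr θ)
      · exact not_killed_of_witnesses hr θ
          (exists_under_w2free_of_eastBlock (sub eastBlock42 5 0 (by decide) ⟨by omega, by omega⟩) hr θ)
          (exists_over_w1free_of_eastBlock (sub eastBlock42 5 0 (by decide) ⟨by omega, by omega⟩) hr θ)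
          (exists_under_w1free_of_interiorBlockSE (sub interiorBlockSE42 5 0 (by decide) ⟨by omega, by omega⟩) hr θ)
          (exists_over_W2FreeOff_of_ringBlockON2a (sub ringBlockON2a42 5 0 (by decide) ⟨by omega, by omega⟩) hr θ)
    · -- top row of the ring: reference cells (1,4) … (5,4)
      rcases hx with rfl | rfl | rfl | rfl | rfl
      · exact not_killed_of_witnesses hr θ
          (exists_under_W2FreeOff_of_ringBlockUS2a (sub ringBlockUS2a42 1 4 (by decide) ⟨by omega, by omega⟩) hr θ)
          (exists_over_w1free_of_interiorBlockNW (sub interiorBlockNW42 1 4 (by decide) ⟨by omega, by omega⟩) hr θ)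
          (exists_under_w1free_of_westBlock (sub westBlock42 1 4 (by decide) ⟨by omega, by omega⟩) hr θ)
          (exists_over_w2free_of_westBlock (sub westBlock42 1 4 (by decide) ⟨by omega, by omega⟩) hr θ)
      · exact not_killed_of_witnesses hr θ
          (exists_under_w2free_of_interiorBlockSW (sub interiorBlockSW42 2 4 (by decide) ⟨by omega, by omega⟩) hr θ)
          (exists_over_w1free_of_interiorBlockNW (sub interiorBlockNW42 2 4 (by decide) ⟨by omega, by omega⟩) hr θ)
          (exists_under_W1FreeOff_of_ringBlockUS1a (sub ringBlockUS1a42 2 4 (by decide) ⟨by omega, by omega⟩) hr θ)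
          (exists_over_W2FreeOff_of_ringBlockON2a (sub ringBlockON2a42 2 4 (by decide) ⟨by omega, by omega⟩) hr θ)
      · exact not_killed_of_witnesses hr θ
          (exists_under_w2free_of_interiorBlockSW (sub interiorBlockSW42 3 4 (by decide) ⟨by omega, by omega⟩) hr θ)
          (exists_over_w1free_of_interiorBlockNW (sub interiorBlockNW42 3 4 (by decide) ⟨by omega, by omega⟩) hr θ)
          (exists_under_W1FreeOff_of_ringBlockUS1a (sub ringBlockUS1a42 3 4 (by decide) ⟨by omega, by omega⟩) hr θ)
          (exists_over_W2FreeOff_of_ringBlockON2a (sub ringBlockON2a42 3 4 (by decide) ⟨by omega, by omega⟩) hr θ)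
      · exact not_killed_of_witnesses hr θ
          (exists_under_w2free_of_interiorBlockSW (sub interiorBlockSW42 4 4 (by decide) ⟨by omega, by omega⟩) hr θ)
          (exists_over_w1free_of_interiorBlockNW (sub interiorBlockNW42 4 4 (by decide) ⟨by omega, by omega⟩) hr θ)
          (exists_under_W1FreeOff_of_ringBlockUS1a (sub ringBlockUS1a42 4 4 (by decide) ⟨by omega, by omega⟩) hr θ)
          (exists_over_W2FreeOff_of_ringBlockON2a (sub ringBlockON2a42 4 4 (by decide) ⟨by omega, by omega⟩) hr θ)
      · exact not_killed_of_witnesses hr θ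
          (exists_under_w2free_of_eastBlock (sub eastBlock42 5 4 (by decide) ⟨by omega, by omega⟩) hr θ)
          (exists_over_w1free_of_eastBlock (sub eastBlock42 5 4 (by decide) ⟨by omega, by omega⟩) hr θ)
          (exists_under_W1FreeOff_of_ringBlockUS1a (sub ringBlockUS1a42 5 4 (by decide) ⟨by omega, by omega⟩) hr θ)
          (exists_over_w2free_of_interiorBlockNE (sub interiorBlockNE42 5 4 (by decide) ⟨by omega, by omega⟩) hr θ)

end Ring

/-! ## §3 The far cell's outer neighbour restores the vertex relation, all boxes -/

section FarWW

variable {m n : ℕ} {h : Face}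

/-- ★★★★ **LAW L, THE SIXTEENTH RING CELL, ALL BOXES: removing the far cell's outer neighbour `(h.1 − 2, h.2)` makes the
vertex functional with the printed weights VANISH identically on `[π/3, 2π/3]`** — a door of the far cell is closed, so no
class-`B2a` walk at the far cell is wound (`ΩG.routeMassW_eq_zero_of_door_closed`); hole `h` anywhere with `2 ≤ h.1`
(the west-wall case is `lawL_westWall_farWW_eq_zero`). [cite: GlazmanManolescu2019, Lemma 2.1 (proof: [Gl])]
[cite: Glazman2015WeightedSAW, Lemma 3.1 (proof, pp. 6–7)] -/
theorem lawL_box_farWW_eq_zero (hW : 2 ≤ h.1) (hE : h.1 + 2 ≤ m) (hS : 0 ≤ h.2) (hN : h.2 + 1 ≤ n) {θ : ℝ}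
    (hθ : θ ∈ Set.Icc (π / 3) (2 * π / 3)) :
    vertexFunctional (printedWeights θ) tFiveEighths (ybCoeff θ) (boxMinus m n [h, (h.1 - 2, h.2)])
      (Face.side (h.1 + 1, h.2) .W) (farW (h.1 + 1, h.2)) = 0 := by
  have hf : farW ((h.1 + 1, h.2) : Face) ∈ boxMinus m n [h, (h.1 - 2, h.2)] := by
    rw [mem_boxMinus]; simp only [farW, List.mem_cons, List.not_mem_nil, or_false, not_or]
    refine ⟨⟨by omega, by omega, by omega, by omega⟩, fun e => ?_, fun e => ?_⟩
    · have e' := Prod.ext_iff.1 e; simp only at e'; omega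
    · have e' := Prod.ext_iff.1 e; simp only at e'; omega
  have hh : holeFaceW ((h.1 + 1, h.2) : Face) ∉ dom (boxMinus m n [h, (h.1 - 2, h.2)]) := by
    rw [holeFaceW_hroot]; exact not_mem_dom_boxMinus_of_mem (by simp)
  have hr : RootedFace (dom (boxMinus m n [h, (h.1 - 2, h.2)])) (Face.side (h.1 + 1, h.2) .W) (farW (h.1 + 1, h.2)) :=
    ⟨hf, fun hb => hh (by rw [root_faces_W] at hb; exact hb.1)⟩
  refine vertexFunctional_printed_farCellW_eq_zero_of_door_closed hθ _ _ hf hh (Or.inr (Or.inr ?_)) hr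
  have e : farWW ((h.1 + 1, h.2) : Face) = ((h.1 - 2, h.2) : Face) := Prod.ext (by simp only [farWW]; omega) rfl
  rw [e]; exact not_mem_dom_boxMinus_of_mem (by simp)

end FarWW

/-! ## §4 LAW L in the interior, complete -/

section Interior

variable {m n : ℕ} {h : Face}

/-- ★★★★★ **LAW L IN THE INTERIOR OF A BOX, COMPLETE.** In the `m × n` box with the hole `h` at distance `≥ 3` from every
wall, remove the hole and ONE cell `(x, y)` at Chebyshev distance `≥ 2` from the hole, other than the far cell's outer
neighbour `(h.1 − 2, h.2)`. Then at every angle NONE of the four universal kill statements of LAW L holds at the far cell of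
the root plaquette `(h.1 + 1, h.2)`: no such cell kills a route (ring cells: `lawL_box_ring_not_killed`; cells at distance
`≥ 3`: `lawL_box_not_killed_of_far`). The excluded cell restores the vertex relation identically (`lawL_box_farWW_eq_zero`).
[cite: GlazmanManolescu2019, §1 (Fig. 2 and the remark after eq. (1)), §2.1, §4.2, Lemma 2.1]
[cite: Glazman2015WeightedSAW, Lemma 3.1 (proof, pp. 6–7)] [cite: CourantRobbins1958, Ch. V Appendix §2 (the even–odd rule)] -/
theorem lawL_box_interior_not_killed (hW : 3 ≤ h.1) (hE : h.1 + 4 ≤ m) (hS : 3 ≤ h.2) (hN : h.2 + 4 ≤ n) {x y : ℤ}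
    (hfar : x + 2 ≤ h.1 ∨ h.1 + 2 ≤ x ∨ y + 2 ≤ h.2 ∨ h.2 + 2 ≤ y) (hWW : ¬(x = h.1 - 2 ∧ y = h.2))
    (hr : RootedFace (dom (boxMinus m n [h, (x, y)])) (Face.side (h.1 + 1, h.2) .W) (farW (h.1 + 1, h.2))) (θ : ℝ) :
    (¬ ∀ (ω : ΩG (dom (boxMinus m n [h, (x, y)])) (Face.side (h.1 + 1, h.2) .W) (farW (h.1 + 1, h.2))) (hb : ω.IsB2a),
        ω.2.firstSideG = .S → ω.WE (fun _ => θ) ≠ excursionWinding θ ω.2.firstSideG (ω.z1 hr hb) ω.1 →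
          ¬ω.2.W2FreeOff (farW (h.1 + 1, h.2))) ∧
      (¬ ∀ (ω : ΩG (dom (boxMinus m n [h, (x, y)])) (Face.side (h.1 + 1, h.2) .W) (farW (h.1 + 1, h.2))) (hb : ω.IsB2a),
        ω.2.firstSideG = .N → ω.WE (fun _ => θ) ≠ excursionWinding θ ω.2.firstSideG (ω.z1 hr hb) ω.1 →
          ¬ω.2.W1FreeOff (farW (h.1 + 1, h.2))) ∧
      (¬ ∀ (ω : ΩG (dom (boxMinus m n [h, (x, y)])) (Face.side (h.1 + 1, h.2) .W) (farW (h.1 + 1, h.2))) (hb : ω.IsB2a),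
        ω.2.firstSideG = .S → ω.WE (fun _ => θ) ≠ excursionWinding θ ω.2.firstSideG (ω.z1 hr hb) ω.1 →
          ¬ω.2.W1FreeOff (farW (h.1 + 1, h.2))) ∧
      (¬ ∀ (ω : ΩG (dom (boxMinus m n [h, (x, y)])) (Face.side (h.1 + 1, h.2) .W) (farW (h.1 + 1, h.2))) (hb : ω.IsB2a),
        ω.2.firstSideG = .N → ω.WE (fun _ => θ) ≠ excursionWinding θ ω.2.firstSideG (ω.z1 hr hb) ω.1 →
          ¬ω.2.W2FreeOff (farW (h.1 + 1, h.2))) := by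
  by_cases hnear : h.1 - 2 ≤ x ∧ x ≤ h.1 + 2 ∧ h.2 - 2 ≤ y ∧ y ≤ h.2 + 2
  · exact lawL_box_ring_not_killed hW hE hS hN (by omega) hWW hr θ
  · refine lawL_box_not_killed_of_far (S := [h, (x, y)]) (by omega) (by omega) (by omega) (by omega) ?_ hr θ
    intro s hs
    simp only [List.mem_cons, List.not_mem_nil, or_false] at hs
    rcases hs with rfl | rfl
    · exact Or.inl rfl
    · right; simp only [FarFromHole]; omega

/-- The rooted-face hypothesis of `lawL_box_interior_not_killed` / `lawL_box_ring_not_killed`, discharged: a cell at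
Chebyshev distance `≥ 2` from the hole is not the far cell. [cite: GlazmanManolescu2019, §2.1 (walks start on the boundary of the domain)] -/
theorem rootedFace_hroot_boxMinus_of_two_le (hW : 2 ≤ h.1) (hE : h.1 + 3 ≤ m) (hS : 2 ≤ h.2) (hN : h.2 + 3 ≤ n)
    {x y : ℤ} (hfar : x + 2 ≤ h.1 ∨ h.1 + 2 ≤ x ∨ y + 2 ≤ h.2 ∨ h.2 + 2 ≤ y) :
    RootedFace (dom (boxMinus m n [h, (x, y)])) (Face.side (h.1 + 1, h.2) .W) (farW (h.1 + 1, h.2)) :=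
  rootedFace_hroot_boxMinus_cell hW hE hS hN (by omega)

end Interior

end Literature.Barriers.CriticalPhenomena.PlaquetteWalk
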